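/-
Copyright (c) 2026 the pub-hodgecm-mathlib formalisation cell (harness21).  Prover seat hodgecm-mathlib-F0P3a-p01 (g32), req620 Track A «(D-RAM) FOUR-FRAME» squad
(unit U3_Laws, (KMS) road «MODULO κ-STAGE B», κ-ASSEMBLER «UNSIGNED PAIR», dealer LH4-plan (g11) WORD #53 (1): TOOLS shared by the (κ-B₀)∕(κ-B₂) payers).  2026-09-04.
-/
import Summits.HodgeConjecture.HodgeConjecture.Theorems.F0P3cDyRamDiagonalKappaSplitCountEval      -- ★ κB-T FILE 1 (LH4-p04 (g2)): brings ★ `normSign_eq_of_near` (ω-conductor toolkit), ★ `normSign_one`, ★ Fκ1∕Fκ2, ★ `F0P3cDyRamStableSumSignClasses.normSign_eq_one_or`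
import Summits.HodgeConjecture.HodgeConjecture.Theorems.F0P3cDyRamGlueUnitRationalityDepth         -- ★ (LH4-p09 (g2)): `exists_fixed_v_add_glueUnit_le_iff`
import HarnessLib

/-!
# Crux `H413`, line LH4 «(D-RAM) FOUR-FRAME» road — unit U3_Laws (iii), κ-ASSEMBLER TOOLS: `d ≥ 2` at a wild datum, the GLUE WITNESS of an element datum, norm-sign bookkeeping

Cell `hodgecm-mathlib` (D-0151), FLOOR 0, crux item H413 = `stmt-HodgeConjecture-24833`; lane `--supports stmt-HodgeConjecture-24833 --as helper` (count-neutral).  THEOREMS ONLY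
(no `def`, no instance, no notation, no `sorry`).  Three small facts the κ-assemblies (`F0P3cDyRamKappaCountTypeZero`, its type-2 twin) use (`d ≥ 2` at a wild datum is ★
`F0P3cDyRamDiagonalKappaCoreHangingClass.two_le_d_of_v_two_lt_one`): (2) `exists_glue_witness` — for an element datum at depth `N₀ ≥ d` a `σ`-fixed `f` with `|f + (β−1)∕(α−1)| ≤ |ϖ|^{n₁ − d + 1}` whenever
`n₂ = n₃ ≤ n₁` (★ `exists_fixed_v_add_glueUnit_le_iff` at `e = n₁ − d + 1`, `g = n₁ − n₂`: the deepest glue shell of the foot-0 ∕ core-hanging κ-sockets, serving every `ρ`);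
(3) `abs_cast_normSign` — `|ω(x)| = 1` in `ℚ`; (4) `normSign_one_add_eq_one` — `σ f = f`, `|f| ≤ |ϖ|^{2d}` ⇒ `ω(1 + f) = 1` (★ `normSign_eq_of_near`).
HONEST LABEL.  Count-neutral; nothing printed is asserted; `HC_CM` is proved only modulo the 7 printed citations (2 remaining named inputs: hLiu418 = `stmt-HodgeConjecture-24832`, h413 =
`stmt-HodgeConjecture-24833`) until rung 0 closes.

## References
* [Rogawski1990] J. D. Rogawski, *Automorphic Representations of Unitary Groups in Three Variables*, Ann. of Math. Stud. 123 (1990), §4.9 p. 55, §4.10 p. 58.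
* [Kottwitz1986BaseChangeUnits] R. E. Kottwitz, *Base change for unit elements of Hecke algebras*, Compositio Math. 60 (1986), §1 pp. 240–241.
* [LanglandsShelstad1987] R. P. Langlands, D. Shelstad, *On the definition of transfer factors*, Math. Ann. 278 (1987), §3.
-/

set_option autoImplicit false

noncomputable section

namespace Summit.HodgeConjecture.HodgeConjecture.Cruxes.H413.F0P3cDyRamKappaAssemblyTools

open Literature.NumberTheory.Automorphic Literature.NumberTheory.Automorphic.HermitianLattice
open Literature.NumberTheory.Automorphic.UnitaryLatticeTree Literature.NumberTheory.Automorphic.UnitaryThreeFourFrame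
open Literature.NumberTheory.LocalFields Literature.NumberTheory.LocalFields.WildQuadraticDatum
open Summit.HodgeConjecture.HodgeConjecture.Cruxes.H413.F0P3cDyRamGlueUnitRationalityDepth (exists_fixed_v_add_glueUnit_le_iff)
open scoped Valued WithZero Matrix MatrixGroups

section Facts

variable {K : Type} [Field K] [Valued K ℤᵐ⁰]

/-- **THE GLUE WITNESS.**  For an element datum `(α, β; n₁, n₂, n₃)` at depth `N₀ ≥ d` with `n₂ = n₃ ≤ n₁` there is a `σ`-fixed `f` with `|f + (β−1)∕(α−1)| ≤ |ϖ|^{n₁ − d + 1}` — the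
deepest glue shell any foot-0 ∕ core-hanging κ-socket asks for (★ `exists_fixed_v_add_glueUnit_le_iff` at `e = n₁ − d + 1`, `g = n₁ − n₂`); off that regime `f := 0`.
[cite: Kottwitz1986BaseChangeUnits, §1 pp. 240–241] -/
theorem exists_glue_witness {σ : K →+* K} {ϖ : K} {d t : ℕ} (hD : IsRamifiedQuadraticDatum σ ϖ d t) {α β : K} {N₀ n₁ n₂ n₃ : ℕ}
    (hE : IsElementDatum σ ϖ N₀ α β n₁ n₂ n₃) (hN₀ : d ≤ N₀) :
    ∃ f : K, σ f = f ∧ (n₂ = n₃ → n₂ ≤ n₁ → Valued.v (f + (β - 1) / (α - 1)) ≤ Valued.v ϖ ^ (n₁ - d + 1)) := by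
  obtain ⟨hσ, hvσ, hϖ, hfix, hd, hd1, -⟩ := hD
  obtain ⟨hα, hβ, hαβ, hα1, hβ1, h₁, h₂, h₃, hN₁, hN₂, hN₃⟩ := hE
  by_cases hreg : n₂ = n₃ ∧ n₂ ≤ n₁
  · obtain ⟨h23, h21⟩ := hreg
    have hϖ1 : Valued.v ϖ ≤ 1 := by rw [hϖ, ← WithZero.exp_zero, WithZero.exp_le_exp]; norm_num
    have hαd : Valued.v (α - 1) ≤ Valued.v ϖ ^ d := by rw [h₂]; exact pow_le_pow_right_of_le_one' hϖ1 (by omega)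
    have hβd : Valued.v (β - 1) ≤ Valued.v ϖ ^ d := by rw [h₁]; exact pow_le_pow_right_of_le_one' hϖ1 (by omega)
    have hα10 : α - 1 ≠ 0 := sub_ne_zero.2 hα1
    have hg : Valued.v ((β - 1) / (α - 1)) = Valued.v ϖ ^ (n₁ - n₂) := by
      have hvϖ0 : Valued.v ϖ ≠ 0 := by rw [hϖ]; exact WithZero.coe_ne_zero
      rw [map_div₀, h₁, h₂, div_eq_iff (pow_ne_zero _ hvϖ0), ← pow_add, Nat.sub_add_cancel h21]
    obtain ⟨f, hσf, hf⟩ := (exists_fixed_v_add_glueUnit_le_iff hσ hvσ hfix hϖ hd hd1 hα hβ hα1 hβ1 hαd hβd h₃ (by omega) hg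
      (e := n₁ - d + 1) (by omega)).2 (by omega)
    exact ⟨f, hσf, fun _ _ => hf⟩
  · exact ⟨0, map_zero σ, fun h23 h21 => absurd ⟨h23, h21⟩ hreg⟩

omit [Valued K ℤᵐ⁰] in
/-- A norm sign has absolute value `1` (in `ℚ`). [cite: LanglandsShelstad1987, §3] -/
theorem abs_cast_normSign (σ : K →+* K) (x : K) : |((normSign σ x : ℤ) : ℚ)| = 1 := by
  rcases F0P3cDyRamStableSumSignClasses.normSign_eq_one_or σ x with h | h <;> rw [h] <;> norm_num

/-- **A `2d`-DEEP FIXED PERTURBATION OF `1` IS A NORM CLASS-WISE**: `σ f = f`, `|f| ≤ |ϖ|^{2d}` ⇒ `ω(1 + f) = 1` (★ `normSign_eq_of_near` + ★ `normSign_one`). [cite: Rogawski1990, §4.10 p. 58] -/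
theorem normSign_one_add_eq_one [CompleteSpace K] {σ : K →+* K} {ϖ : K} {d t : ℕ} (hD : IsRamifiedQuadraticDatum σ ϖ d t) {f : K} (hσf : σ f = f)
    (hf : Valued.v f ≤ Valued.v ϖ ^ (2 * d)) : normSign σ (1 + f) = 1 := by
  have h : Valued.v ((1 : K) - (1 + f)) ≤ Valued.v ϖ ^ (2 * d) := by
    rw [show (1 : K) - (1 + f) = -f by ring, Valuation.map_neg]; exact hf
  rw [normSign_eq_of_near hD (map_one σ) (by rw [map_add, map_one, hσf]) (map_one _) (n := 2 * d) (by omega) h]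
  exact normSign_one σ

end Facts


end Summit.HodgeConjecture.HodgeConjecture.Cruxes.H413.F0P3cDyRamKappaAssemblyTools

end
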